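import Summits.QuantumFields.YangMills.Theorems.AtomicCalibrationRMirrorCalibrationKDefs
import Summits.QuantumFields.YangMills.Theorems.OnsetCalibrationOnsetVanishes
import Summits.QuantumFields.YangMills.Theorems.SquareRootCeilingsMirrorDomination
import HarnessLib

/-!
# LINE «CofinalWindows» on the leaf `InfiniteVolumeContinuum.HypercubicOSDataFromInfiniteVolume` (stmt-QuantumFields-19868)

Planner seat `ym-idea-11` g18 (D-0145 ideator, lens «wuc» = weakest unknown consequence), 2026-08-29.
bears_on: LADDER-YM R2a-IV (leaf 19868).

## The observation (wuc)
The leaf quantifies `∃ β_k → ∞`: hypercubic OS data are a limit along ONE sequence of couplings.  Every filed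
N-wall currency (`NT`, `OnsetFloors`, `OnsetFloorsK`, `LowerBoundsK`, FRS's `FloorWithScalingLimits`) asks the
two floors at EVERY large `β`.  The window mechanism of route ForcedResponseSkewness (Feynman–Hellmann sum rule
`∂_β Q2 = Σ_z κ₃`, tree `hasDerivAt_Q2_coupling`; a drop of `Q2` across a fixed coupling window forces a slope,
and the slope is skewness) produces BOTH floors only at ONE coupling `c*(L) ∈ [c₀, c₀+T₀]` PER WINDOW AND PER
TORUS, in the FIXED unit `a(c₀)`; FRS then needs the scaling-limit clauses `Φ₂, Φ₃^f` of its residual to carry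
that configuration to all `β` (obstructions (O1)/(O3) of `Cruxes/NT/Lines/coupling_window_census.md`).
For the LEAF those transports are unnecessary: a coupling selection per torus (`c*(L_j) → c∞` along a torus
subsequence, Bolzano–Weierstrass) plus ONE new regularity input — `L`-UNIFORM LIPSCHITZ CONTINUITY IN THE
COUPLING of the smeared torus two- and three-point functions at fixed lattice tests (by Feynman–Hellmann = an
`L`-uniform bound on the torus-summed third/fourth cumulant; clustering-lite, no rate, no limit) — gives the two
floors at `(c∞, L_j)` for all `j`, i.e. COFINAL floors along a torus subsequence, which is exactly what a
cofinal re-run of the landed engines B6K (`mirrorCalibrationK_proof`) and B7K (`smearedIVDataK_proof`) consumes.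

## Stubs (5) and composition
* `stub_windowFloors : WindowFloorsK` — N-wall, FRS-class OUTPUT currency (per window, per torus, fixed unit);
  weaker than `LowerBoundsK` (proved: `windowFloorsK_of_forall`, `c = c₀`, `T₀ = 0`; from `OnsetFloorsK` one passes
  through the landed `jointOnsetUnit`/`onsetVanishes_proof`, not restated here); contains NT clause (i) only through
  its producers (LINE «CofinalFRS» opens it into route ForcedResponseSkewness's items BY NAME).  [hard; residual-fed]
* `stub_windowResponseBound : WindowResponseBound` (REV 5, CORRECTED N2′) — wherever window floors hold (N1's
  property), the coupling derivative of `Q2_(·,L,a c₀)(θv,v)` / `Q3_(·,L,a c₀)(f,g,h)` is bounded by ONE `K` across every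
  window, uniformly in `L` (`HasDerivAt` form; Feynman–Hellmann = smeared cumulant with one torus-summed action leg);
  N2 `WindowLipschitz` FOLLOWS (proved: `windowLipschitz_of_responseBound`, mean-value inequality on `[c₀, c₀+T₀]`).
  [response ceiling at the floors' unit; E-wall-adjacent upper-bound class]
* `stub_axisMirrorCeilingOnset : AxisMirrorCeilingOnset` (REV E_AM; answers idea-crit-9 #90 P4 (ii)) — item 26791
  `SquareRootCeilings.AxisMirrorCeiling` VERBATIM minus its `∀β`-floor antecedent: the ON-AXIS same-orientation mirror-pair
  ceiling at sub-onset units (a Hausdorff-moment ceiling on one plaquette's spectral measure).  E `SubOnsetTwoPointCeilingsOnset`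
  FOLLOWS by the LANDED reflection-positivity Cauchy–Schwarz `MirrorDomination.abs_cov_le_of_axisMirror` (proved:
  `subOnsetTwoPointCeilingsOnset_of_axisMirrorOnset`); `⇒ 26791` (`axisMirrorCeiling_of_onset`).  [E-wall n = 2, on-axis; open-problem class]
* `stub_smearedMomentBound : SmearedMomentBound` — E-wall n ≥ 2 smeared currency BY NAME (conclusion of the LANDED
  E3 `stub_smearedAtomicBound` from OnsetTautology's atomic items AtomicSynthesis 28167 / AtomicSqrtDominationR 28168 /
  OnsetContraction via AtomCeilings + landed Whitney).  [by name]
* `stub_cofinalEngineB` — SOFT (L/XL, provable-grade): cofinal mirror calibration + cofinal smeared IV engine,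
  `CofinalSubOnsetFloorsK → SubOnsetTwoPointCeilingsOnset → SmearedMomentBound → leaf` (REV 3: starts from the typed
  SUB-ONSET currency; the sub-onset unit selection ENGINE-a′ is PROVED: `cofinalSubOnsetFloorsK_of_cofinalFloorsK`).
* PROVED (REV 2, kernel-checked, sorry-free): the typed cofinal currency `CofinalFloorsK` (∃ β_k → ∞, units
  `u_k → 0`, joint floors along SOME strictly increasing odd-torus sequence per `k`) and the SELECTION
  `cofinalFloorsK_of_windows : WindowFloorsK → WindowLipschitz → CofinalFloorsK` (Bolzano–Weierstrass per
  window + the Lipschitz transfer), i.e. step (1) of the engine is no longer a stub.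
* composition `HypercubicOSDataFromInfiniteVolume_of_cofinalWindows` (sorry-free) concludes the leaf BY NAME:
  (current form) `stub_cofinalEngineB (ENGINE-a′ (cofinalFloorsK_of_windows stub_windowFloors (MVT stub_windowResponseBound))) (E_AM ⇒ E) stub_E′`.

REV 2 (2026-08-29, same day as REV 1 d48dd1ec): adds `CofinalFloorsK` + the proved selection; the engine stub now starts
from `CofinalFloorsK`; stubs N1, N2, E, E′ unchanged character for character.
REV 3 (2026-08-29; answers idea-crit-9 #90/#90a P1′, P2, P3): (P3) N2 is DERIVED from the typed Feynman–Hellmann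
currency `SummedResponseBoundK` by the mean-value inequality (proved); (P1′) the engine is split once more at the typed
`CofinalSubOnsetFloorsK` (cofinal floors at a SUB-ONSET unit `w_k → 0`, per level `ε ≤ ε₁` and per threshold `Λ₅`)
and the split's first half ENGINE-a′ `CofinalFloorsK → CofinalSubOnsetFloorsK` is PROVED sorry-free (exhaustive case
split per `k`: the near-maximal `∀L`-floor scale in `[2u_k, 1]` via `sSup`, else `u_k`; `w_k → 0` by the landed
`onsetVanishes_proof`); (P2) the docstring no longer claims `WindowFloorsK < OnsetFloorsK` beyond the proved
`LowerBoundsK` shape.  Composition: `stub_cofinalEngineB (ENGINE-a′ (selection N1 (MVT N2′))) E E′`.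

REV 4 (2026-08-29; answers idea-crit-9 #90 P4 option (ii) IN THE KERNEL): the E stub is now E_AM `AxisMirrorCeilingOnset` =
item 26791 `SquareRootCeilings.AxisMirrorCeiling` minus its `∀β` floor antecedent (on-axis mirror pairs only), and
E `SubOnsetTwoPointCeilingsOnset` is DERIVED from it by the landed reflection-positivity Cauchy–Schwarz
(`MirrorDomination.abs_cov_le_of_axisMirror`; `subOnsetTwoPointCeilingsOnset_of_axisMirrorOnset`, sorry-free).

REV 5 (2026-08-29; SELF-AUDIT CORRECTION of N2/N2′): the free-standing currencies `CouplingEquicontinuity` / `SummedResponseBoundK` of the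
earlier revisions quantified over ALL compactly supported test pairs (including overlapping supports, where the contact terms of
the bare `Q2` scale like `s⁻⁴` with a non-vanishing coupling derivative) and over ALL units `s ∈ (0,1]` (including the
infrared regime `s ≪ a(β)`): MIS-TYPED (false as stated for overlapping pairs).  They are REPLACED by the window-local,
floor-data-conditioned `WindowLipschitz` / `WindowResponseBound` (N1's disjoint tests, N1's unit `a(c₀)`, couplings inside the window) —
exactly what the selection `cofinalFloorsK_of_windows` consumes; the selection and the MVT lemma are re-proved for them.

REV 6 (2026-08-29; dedup, idea-crit-9 #90b/#91a (b)): N2/N2′ are now ONE statement `WindowLipschitz` / `WindowResponseBound`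
(Schwartz `f`, compactly supported `v, g, h`, pairwise disjoint) with the SAME body in both g18 line files — this line instantiates it
with its compact quadruple `(v, f, g, h)`; one landing of the body discharges both lines' N2′ stubs by `exact`.

REV 7 (2026-08-29; idea-crit-9 #90c∕#91b (3b) price P2, form β — «own or cut the zero-test instance»): E_AM and E are
RE-TYPED ONSET-CONDITIONED pointwise in `(β, s)` — `AxisMirrorCeilingOnset` / `SubOnsetTwoPointCeilingsOnset` carry the
hypotheses (a) «`s` carries both floors of level `ε` along a strictly increasing torus sequence» and (b) «no unit in
`[2s,1]` carries the `∀L`-floors» (exactly clauses (a), (b) of `CofinalSubOnsetFloorsK`), replacing the deleted `∀β`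
antecedent of 26791 / 26671: the zero-test ∕ floor-less instances (which made the REV 4–6 antecedent-free forms
contain the test-free all-distance `t⁻⁸` law) are now VACUOUS, «below onset» is meaningful again, and BOTH items
follow BY NAME (`axisMirrorCeiling_of_onset`, `subOnsetTwoPointCeilings_of_onset`: near-top `∀L`-floor unit,
`exists_onset_unit`).  ENGINE-b consumes the conditioned E (it instantiates at `(β_k, w_k)` anyway).  The REV 4–6
names `…Free` are superseded by `…Onset` throughout (history paragraphs above use the new names).

HONEST LABEL: a SKELETON; it proves no stub, no crux, no rung, no leaf and no summit; nothing about Bałaban's RG or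
Clay is asserted; the Yang–Mills mass gap is NOT proved.
-/

set_option autoImplicit false

noncomputable section

open scoped BigOperators
open MeasureTheory Filter Topology
open Literature.MathematicalPhysics.QuantumFieldTheory Literature.MathematicalPhysics.QuantumLattice
open Literature.MathematicalPhysics.AQFT (IsOffDiagonal)
open Summit.QuantumFields.YangMills.Theorems.InfiniteVolume (stateMomentStr)
open Summit.QuantumFields.YangMills.Cruxes.OSLegsFromFemtoAndGap.DlrCollarTransfer (Q2 Q3 torusE plane)
open Summit.QuantumFields.YangMills.Cruxes.AtomicCalibrationR.MirrorCalibration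
  (SmearedMomentBound onsetSet IsAdmissibleProfile LowerBoundsK)

namespace Summit.QuantumFields.YangMills.Cruxes.HypercubicOSDataFromInfiniteVolume.CofinalWindows

/-! ## §1 The three typed currencies -/

/-- **N1 `WindowFloorsK` — window floors (FRS-class output currency).**  For every SU(2)-class `G`: a lattice
representation `r`, a unit `a : ℝ → ℝ` (positive, `→ 0`), compactly supported real witnesses `v` (positive time) and
pairwise disjoint `f, g, h`, a level `ε > 0` and a window length `T₀ ≥ 0` such that in EVERY coupling window
`[c₀, c₀+T₀]` (`c₀ ≥ β₅`) and on EVERY odd torus `2L+1` with `a(c₀)·L ≥ Λ₅` there is a coupling `c` (allowed to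
depend on `L`) at which BOTH floors hold in the FIXED unit `a(c₀)`: `ε ≤ Q2_(c,L,a c₀)(θv,v)` and `ε ≤ |Q3_(c,L,a c₀)(f,g,h)|`.
Weaker than `LowerBoundsK` (`c := c₀`; proved below `windowFloorsK_of_forall`). -/
def WindowFloorsK : Prop :=
  ∀ (G : Type) [Group G] [TopologicalSpace G] [IsTopologicalGroup G] [CompactSpace G],
    IsCompactSimpleLieGroup G → Nonempty (G ≃ₜ* Matrix.specialUnitaryGroup (Fin 2) ℂ) →
    letI : MeasurableSpace G := borel G
    haveI : BorelSpace G := ⟨rfl⟩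
    ∃ (r : LatticeRep G) (a : ℝ → ℝ) (v f g h : SchwartzMap (EuclideanSpace ℝ (Fin 4)) ℝ) (ε T₀ Λ₅ β₅ : ℝ),
      HasCompactSupport (v : EuclideanSpace ℝ (Fin 4) → ℝ) ∧ HasCompactSupport (f : EuclideanSpace ℝ (Fin 4) → ℝ) ∧
      HasCompactSupport (g : EuclideanSpace ℝ (Fin 4) → ℝ) ∧ HasCompactSupport (h : EuclideanSpace ℝ (Fin 4) → ℝ) ∧
      tsupport v ⊆ {y : EuclideanSpace ℝ (Fin 4) | 0 < y 0} ∧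
      Disjoint (tsupport f) (tsupport g) ∧ Disjoint (tsupport g) (tsupport h) ∧ Disjoint (tsupport f) (tsupport h) ∧
      (∀ β, 0 < a β) ∧ Tendsto a atTop (nhds 0) ∧ 0 < ε ∧ 0 ≤ T₀ ∧
      ∀ c₀ : ℝ, β₅ ≤ c₀ → ∀ L : ℕ, Λ₅ ≤ a c₀ * L → ∃ c : ℝ, c₀ ≤ c ∧ c ≤ c₀ + T₀ ∧
        ε ≤ Q2 G r c L (a c₀) (thetaTest 4 v) v ∧ ε ≤ |Q3 G r c L (a c₀) f g h|

/-- **N2 `WindowLipschitz` — window-local Lipschitz continuity in the coupling AT THE FLOORS' UNIT (CORRECTED currency; ONE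
statement shared character for character by both g18 lines).**  WHEREVER window floors hold — for any data
`(r, a, v, f, g, h, ε, T₀, Λ₅, β₅)` (Schwartz tests; `v, g, h` compactly supported, `v` positive-time; `f, g, h` pairwise
disjointly supported; some `c ∈ [c₀, c₀+T₀]` carries the two-point floor of `(θv, v)` and the three-point floor of
`(f, g, h)` at the unit `a(c₀)` on every torus `a(c₀)·L ≥ Λ₅`, for every window `c₀ ≥ β₅`) — the smeared torus two- and
three-point functions at that unit are `K`-Lipschitz in the coupling ACROSS THE WINDOW `[c₀, c₀+T₀]`, with ONE `K` for
all windows `c₀ ≥ β₆` and all tori `a(c₀)·L ≥ Λ₆`.  (The free-standing forms of the earlier revisions, quantified over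
ALL test pairs — overlapping supports included, where the contact terms of the bare `Q2` scale like `s⁻⁴` with a
non-vanishing coupling derivative — and over ALL units `s ∈ (0,1]`, were MIS-TYPED and are withdrawn.  This form
quantifies exactly what the selection consumes: the floors' disjoint tests, the floors' unit, couplings in the window.) -/
def WindowLipschitz : Prop :=
  ∀ (G : Type) [Group G] [TopologicalSpace G] [IsTopologicalGroup G] [CompactSpace G],
    IsCompactSimpleLieGroup G → Nonempty (G ≃ₜ* Matrix.specialUnitaryGroup (Fin 2) ℂ) →
    letI : MeasurableSpace G := borel G
    haveI : BorelSpace G := ⟨rfl⟩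
    ∀ (r : LatticeRep G) (a : ℝ → ℝ) (v f g h : SchwartzMap (EuclideanSpace ℝ (Fin 4)) ℝ) (ε T₀ Λ₅ β₅ : ℝ),
      HasCompactSupport (v : EuclideanSpace ℝ (Fin 4) → ℝ) → HasCompactSupport (g : EuclideanSpace ℝ (Fin 4) → ℝ) →
      HasCompactSupport (h : EuclideanSpace ℝ (Fin 4) → ℝ) → tsupport v ⊆ {y : EuclideanSpace ℝ (Fin 4) | 0 < y 0} →
      Disjoint (tsupport f) (tsupport g) → Disjoint (tsupport g) (tsupport h) → Disjoint (tsupport f) (tsupport h) →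
      (∀ β, 0 < a β) → Tendsto a atTop (nhds 0) → 0 < ε → 0 ≤ T₀ →
      (∀ c₀ : ℝ, β₅ ≤ c₀ → ∀ L : ℕ, Λ₅ ≤ a c₀ * L → ∃ c : ℝ, c₀ ≤ c ∧ c ≤ c₀ + T₀ ∧
        ε ≤ Q2 G r c L (a c₀) (thetaTest 4 v) v ∧ ε ≤ |Q3 G r c L (a c₀) f g h|) →
      ∃ (K Λ₆ β₆ : ℝ), 0 ≤ K ∧ ∀ c₀ : ℝ, β₆ ≤ c₀ → ∀ β β' : ℝ,
        c₀ ≤ β → β ≤ c₀ + T₀ → c₀ ≤ β' → β' ≤ c₀ + T₀ → ∀ L : ℕ, Λ₆ ≤ a c₀ * L →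
          |Q2 G r β L (a c₀) (thetaTest 4 v) v - Q2 G r β' L (a c₀) (thetaTest 4 v) v| ≤ K * |β - β'| ∧
          |Q3 G r β L (a c₀) f g h - Q3 G r β' L (a c₀) f g h| ≤ K * |β - β'|

/-- **N2′ `WindowResponseBound` — the Feynman–Hellmann form of N2 (the registered stub's statement; ONE statement shared
character for character by both g18 lines, so that one landing discharges both).**  Same antecedent; conclusion: ONE
constant `K` bounding the coupling DERIVATIVE of `c ↦ Q2_(c,L,a c₀)(θv,v)` and `c ↦ Q3_(c,L,a c₀)(f,g,h)` at every
coupling of every window `[c₀, c₀+T₀]`, `c₀ ≥ β₆`, on every torus `a(c₀)·L ≥ Λ₆` (`HasDerivAt` form; by the tree's sum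
rule `hasDerivAt_Q2_coupling` the derivative IS the smeared third cumulant with the total action — a RESPONSE CEILING
at the floors' unit with one torus-summed leg; E-wall-adjacent upper-bound class, n = 2, 3, derivative form). -/
def WindowResponseBound : Prop :=
  ∀ (G : Type) [Group G] [TopologicalSpace G] [IsTopologicalGroup G] [CompactSpace G],
    IsCompactSimpleLieGroup G → Nonempty (G ≃ₜ* Matrix.specialUnitaryGroup (Fin 2) ℂ) →
    letI : MeasurableSpace G := borel G
    haveI : BorelSpace G := ⟨rfl⟩
    ∀ (r : LatticeRep G) (a : ℝ → ℝ) (v f g h : SchwartzMap (EuclideanSpace ℝ (Fin 4)) ℝ) (ε T₀ Λ₅ β₅ : ℝ),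
      HasCompactSupport (v : EuclideanSpace ℝ (Fin 4) → ℝ) → HasCompactSupport (g : EuclideanSpace ℝ (Fin 4) → ℝ) →
      HasCompactSupport (h : EuclideanSpace ℝ (Fin 4) → ℝ) → tsupport v ⊆ {y : EuclideanSpace ℝ (Fin 4) | 0 < y 0} →
      Disjoint (tsupport f) (tsupport g) → Disjoint (tsupport g) (tsupport h) → Disjoint (tsupport f) (tsupport h) →
      (∀ β, 0 < a β) → Tendsto a atTop (nhds 0) → 0 < ε → 0 ≤ T₀ →
      (∀ c₀ : ℝ, β₅ ≤ c₀ → ∀ L : ℕ, Λ₅ ≤ a c₀ * L → ∃ c : ℝ, c₀ ≤ c ∧ c ≤ c₀ + T₀ ∧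
        ε ≤ Q2 G r c L (a c₀) (thetaTest 4 v) v ∧ ε ≤ |Q3 G r c L (a c₀) f g h|) →
      ∃ (K Λ₆ β₆ : ℝ), 0 ≤ K ∧ ∀ c₀ : ℝ, β₆ ≤ c₀ → ∀ β : ℝ, c₀ ≤ β → β ≤ c₀ + T₀ →
        ∀ L : ℕ, Λ₆ ≤ a c₀ * L →
          (∃ D : ℝ, HasDerivAt (fun c : ℝ => Q2 G r c L (a c₀) (thetaTest 4 v) v) D β ∧ |D| ≤ K) ∧
          (∃ D : ℝ, HasDerivAt (fun c : ℝ => Q3 G r c L (a c₀) f g h) D β ∧ |D| ≤ K)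

/-- Mean-value inequality on `[lo, hi]`: a derivative bound `K` at every point gives the Lipschitz bound `K`. [folklore] -/
private theorem abs_sub_le_of_hasDerivAt_bound_Icc (q : ℝ → ℝ) (K lo hi : ℝ)
    (hq : ∀ β : ℝ, lo ≤ β → β ≤ hi → ∃ D : ℝ, HasDerivAt q D β ∧ |D| ≤ K) (β β' : ℝ)
    (hβ1 : lo ≤ β) (hβ2 : β ≤ hi) (hβ'1 : lo ≤ β') (hβ'2 : β' ≤ hi) :
    |q β - q β'| ≤ K * |β - β'| := by
  have hderiv : ∀ x ∈ Set.Icc lo hi, HasDerivWithinAt q (deriv q x) (Set.Icc lo hi) x := by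
    intro x hx
    obtain ⟨D, hD, -⟩ := hq x hx.1 hx.2
    exact (hD.differentiableAt.hasDerivAt).hasDerivWithinAt
  have hbound : ∀ x ∈ Set.Icc lo hi, ‖deriv q x‖ ≤ K := by
    intro x hx
    obtain ⟨D, hD, hDK⟩ := hq x hx.1 hx.2
    rw [hD.deriv, Real.norm_eq_abs]
    exact hDK
  have h := (convex_Icc lo hi).norm_image_sub_le_of_norm_hasDerivWithin_le hderiv hbound ⟨hβ'1, hβ'2⟩ ⟨hβ1, hβ2⟩
  simpa [Real.norm_eq_abs] using h

/-- **N2′ ⟹ N2 (kernel-checked):** the window response bound gives window Lipschitz continuity, same constant and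
thresholds, by the mean-value inequality on `[c₀, c₀+T₀]`. -/
theorem windowLipschitz_of_responseBound (hN : WindowResponseBound) : WindowLipschitz := by
  intro G _ _ _ _ hG hcl
  letI : MeasurableSpace G := borel G
  haveI : BorelSpace G := ⟨rfl⟩
  intro r a v f g h ε T₀ Λ₅ β₅ hvK hgK hhK hv hfg hgh hfh hapos ha0 hε hT₀ hW
  obtain ⟨K, Λ₆, β₆, hK, hD⟩ := hN G hG hcl r a v f g h ε T₀ Λ₅ β₅ hvK hgK hhK hv hfg hgh hfh hapos ha0 hε hT₀ hW
  refine ⟨K, Λ₆, β₆, hK, fun c₀ hc₀ β β' h1 h2 h1' h2' L hL => ⟨?_, ?_⟩⟩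
  · exact abs_sub_le_of_hasDerivAt_bound_Icc (fun c : ℝ => Q2 G r c L (a c₀) (thetaTest 4 v) v) K c₀ (c₀ + T₀)
      (fun b hb1 hb2 => (hD c₀ hc₀ b hb1 hb2 L hL).1) β β' h1 h2 h1' h2'
  · exact abs_sub_le_of_hasDerivAt_bound_Icc (fun c : ℝ => Q3 G r c L (a c₀) f g h) K c₀ (c₀ + T₀)
      (fun b hb1 hb2 => (hD c₀ hc₀ b hb1 hb2 L hL).2) β β' h1 h2 h1' h2'

/-- **E `SubOnsetTwoPointCeilingsOnset` — item 26671 `SquareRootCeilings.SubOnsetTwoPointCeilings` ONSET-CONDITIONED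
pointwise in `(β, s)`** (REV 7∕6; answers idea-crit-9 #90c (3b) price P2, form β).  The `∀β` onset-floor antecedent of
26671 is replaced by two hypotheses AT `(β, s)`: (a) the unit `s` carries BOTH floors of level `ε` along a strictly
increasing odd-torus sequence, (b) no unit `s' ∈ [2s, 1]` carries the two `∀L`-floors of level `ε` (threshold `Λ₅`) —
exactly clauses (a), (b) of `CofinalSubOnsetFloorsK` at `(β_k, w_k)`; conclusion verbatim (`|Cov_T(P_q(x), P_q'(y))|
≤ (C/R⁴)²` for cyclically `(2R+4)`-separated pairs, `R s ≤ ℓ₄`, `4R+8 ≤ L`).  The zero-test and floor-less instances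
are VACUOUS (no unit carries floors), so the statement owes ceilings ONLY at onset units of floor-carrying couplings,
`R ≤ ℓ₄/s` = the hyperscaling regime below the tests' onset — «sub-onset» keeps its meaning.  `⇒ 26671` BY NAME
(`subOnsetTwoPointCeilings_of_onset`, a supremum argument over the `∀L`-floor units). -/
def SubOnsetTwoPointCeilingsOnset : Prop :=
  ∀ (G : Type) [Group G] [TopologicalSpace G] [IsTopologicalGroup G] [CompactSpace G],
    IsCompactSimpleLieGroup G → Nonempty (G ≃ₜ* Matrix.specialUnitaryGroup (Fin 2) ℂ) →
    letI : MeasurableSpace G := borel G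
    haveI : BorelSpace G := ⟨rfl⟩
    ∀ (r : LatticeRep G) (v f g h : SchwartzMap (EuclideanSpace ℝ (Fin 4)) ℝ) (Λ₅ : ℝ), ∃ ε₀ : ℝ, 0 < ε₀ ∧
      ∀ ε : ℝ, 0 < ε → ε ≤ ε₀ → ∃ (C ℓ₄ β₄ : ℝ), 0 < ℓ₄ ∧ 0 ≤ C ∧ ∀ β : ℝ, β₄ ≤ β → ∀ s : ℝ, 0 < s → s ≤ 1 →
        (∃ S : ℕ → ℕ, StrictMono S ∧ ∀ j,
            ε ≤ Q2 G r β (S j) s (thetaTest 4 v) v ∧ ε ≤ |Q3 G r β (S j) s f g h|) →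
        (∀ s' : ℝ, 2 * s ≤ s' → s' ≤ 1 →
          ¬ ((∀ L : ℕ, Λ₅ ≤ s' * L → ε ≤ Q2 G r β L s' (thetaTest 4 v) v) ∧
             (∀ L : ℕ, Λ₅ ≤ s' * L → ε ≤ |Q3 G r β L s' f g h|))) →
        ∀ (L : ℕ) (q q' : Fin 4 × Fin 4) (x y : Fin 4 → ℤ) (R : ℕ), q.1 < q.2 → q'.1 < q'.2 → 1 ≤ R →
          (R : ℝ) * s ≤ ℓ₄ → 4 * R + 8 ≤ L →
          (∃ k : Fin 4, (2 * (R : ℤ) + 4) ≤ |((((x k - y k : ℤ) : ZMod (2 * L + 1))).valMinAbs : ℤ)|) →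
          |torusE G r β L (fun U => (plane G r q x U - torusE G r β L (plane G r q x)) *
            (plane G r q' y U - torusE G r β L (plane G r q' y)))| ≤ (C / (R : ℝ) ^ 4) ^ 2

/-- **E_AM `AxisMirrorCeilingOnset`** — item 26791 `SquareRootCeilings.AxisMirrorCeiling` ONSET-CONDITIONED pointwise in
`(β, s)` (same hypotheses (a), (b) as E; conclusion verbatim: the ON-AXIS same-orientation mirror-pair plaquette
covariance at axis separation `t ∈ [2R+2, L]`, `R·s ≤ ℓ₄`, `4R+8 ≤ L`, is `≤ (C/R⁴)²` — a Hausdorff-moment ceiling on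
one plaquette's spectral measure, the open E-wall content of route SquareRootCeilings, on-axis, owed only at onset
units of floor-carrying couplings).  `⇒ 26791` BY NAME (`axisMirrorCeiling_of_onset`); `⇒ E` by the LANDED
reflection-positivity Cauchy–Schwarz `MirrorDomination.abs_cov_le_of_axisMirror` (`subOnsetTwoPointCeilingsOnset_of_axisMirrorOnset`). -/
def AxisMirrorCeilingOnset : Prop :=
  ∀ (G : Type) [Group G] [TopologicalSpace G] [IsTopologicalGroup G] [CompactSpace G],
    IsCompactSimpleLieGroup G → Nonempty (G ≃ₜ* Matrix.specialUnitaryGroup (Fin 2) ℂ) →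
    letI : MeasurableSpace G := borel G
    haveI : BorelSpace G := ⟨rfl⟩
    ∀ (r : LatticeRep G) (v f g h : SchwartzMap (EuclideanSpace ℝ (Fin 4)) ℝ) (Λ₅ : ℝ), ∃ ε₀ : ℝ, 0 < ε₀ ∧
      ∀ ε : ℝ, 0 < ε → ε ≤ ε₀ → ∃ (C ℓ₄ β₄ : ℝ), 0 < ℓ₄ ∧ 0 ≤ C ∧ ∀ β : ℝ, β₄ ≤ β → ∀ s : ℝ, 0 < s → s ≤ 1 →
        (∃ S : ℕ → ℕ, StrictMono S ∧ ∀ j,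
            ε ≤ Q2 G r β (S j) s (thetaTest 4 v) v ∧ ε ≤ |Q3 G r β (S j) s f g h|) →
        (∀ s' : ℝ, 2 * s ≤ s' → s' ≤ 1 →
          ¬ ((∀ L : ℕ, Λ₅ ≤ s' * L → ε ≤ Q2 G r β L s' (thetaTest 4 v) v) ∧
             (∀ L : ℕ, Λ₅ ≤ s' * L → ε ≤ |Q3 G r β L s' f g h|))) →
        ∀ (L : ℕ) (q : Fin 4 × Fin 4) (k : Fin 4) (R t : ℕ), q.1 < q.2 → 1 ≤ R → (R : ℝ) * s ≤ ℓ₄ →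
          4 * R + 8 ≤ L → 2 * R + 2 ≤ t → t ≤ L →
          |torusE G r β L (fun U => (plane G r q (fun i => if i = k then (t : ℤ) else 0) U -
              torusE G r β L (plane G r q (fun i => if i = k then (t : ℤ) else 0))) *
            (plane G r q (fun _ => 0) U - torusE G r β L (plane G r q (fun _ => 0))))| ≤ (C / (R : ℝ) ^ 4) ^ 2

/-- **E_AM ⟹ E (kernel-checked port of the landed `MirrorDomination`, stmt 26792):** the on-axis mirror-pair ceiling
dominates every cyclically `(2R+4)`-separated plaquette pair by reflection-positivity Cauchy–Schwarz
(`MirrorDomination.abs_cov_le_of_axisMirror`, pointwise in `(β, s, L)`; reflection positivity used at `β ≥ 0`). -/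
theorem subOnsetTwoPointCeilingsOnset_of_axisMirrorOnset (hE : AxisMirrorCeilingOnset) :
    SubOnsetTwoPointCeilingsOnset := by
  intro G _ _ _ _ hG hcl
  letI : MeasurableSpace G := borel G
  haveI : BorelSpace G := ⟨rfl⟩
  intro r v f g h Λ₅
  obtain ⟨ε₀, hε₀, hA1⟩ := hE G hG hcl r v f g h Λ₅
  refine ⟨ε₀, hε₀, fun ε hε hεε => ?_⟩
  obtain ⟨C, ℓ₄, β₄, hℓ₄, hC, hA2⟩ := hA1 ε hε hεε
  refine ⟨C, ℓ₄, max β₄ 0, hℓ₄, hC, fun β hβ s hs hs1 hfl hsub L q q' x y R hq hq' hR hRs hRL hsep => ?_⟩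
  have hβ4 : β₄ ≤ β := le_trans (le_max_left _ _) hβ
  have hβ0 : (0 : ℝ) ≤ β := le_trans (le_max_right _ _) hβ
  obtain ⟨k, hk⟩ := hsep
  exact Summit.QuantumFields.YangMills.Theorems.MirrorDomination.abs_cov_le_of_axisMirror G r hβ0 hR hRL
    (fun q₁ t hq₁ ht htL => hA2 β hβ4 s hs hs1 hfl hsub L q₁ 0 R t hq₁ hR hRs hRL ht htL) hq hq' x y k hk

/-- `LowerBoundsK`-type floors at every large coupling give the window floors trivially (`c := c₀`, `T₀ := 0`):
`WindowFloorsK` is WEAKER than the `∀β` currency. [bookkeeping; the wuc direction] -/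
theorem windowFloorsK_of_forall
    (h : ∀ (G : Type) [Group G] [TopologicalSpace G] [IsTopologicalGroup G] [CompactSpace G],
      IsCompactSimpleLieGroup G → Nonempty (G ≃ₜ* Matrix.specialUnitaryGroup (Fin 2) ℂ) →
      letI : MeasurableSpace G := borel G
      haveI : BorelSpace G := ⟨rfl⟩
      ∃ (r : LatticeRep G) (a : ℝ → ℝ) (v f g h : SchwartzMap (EuclideanSpace ℝ (Fin 4)) ℝ) (ε Λ₅ β₅ : ℝ),
        HasCompactSupport (v : EuclideanSpace ℝ (Fin 4) → ℝ) ∧ HasCompactSupport (f : EuclideanSpace ℝ (Fin 4) → ℝ) ∧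
        HasCompactSupport (g : EuclideanSpace ℝ (Fin 4) → ℝ) ∧ HasCompactSupport (h : EuclideanSpace ℝ (Fin 4) → ℝ) ∧
        tsupport v ⊆ {y : EuclideanSpace ℝ (Fin 4) | 0 < y 0} ∧
        Disjoint (tsupport f) (tsupport g) ∧ Disjoint (tsupport g) (tsupport h) ∧ Disjoint (tsupport f) (tsupport h) ∧
        (∀ β, 0 < a β) ∧ Tendsto a atTop (nhds 0) ∧ 0 < ε ∧
        ∀ β : ℝ, β₅ ≤ β → ∀ L : ℕ, Λ₅ ≤ a β * L →
          ε ≤ Q2 G r β L (a β) (thetaTest 4 v) v ∧ ε ≤ |Q3 G r β L (a β) f g h|) :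
    WindowFloorsK := by
  intro G _ _ _ _ hG hcl
  letI : MeasurableSpace G := borel G
  haveI : BorelSpace G := ⟨rfl⟩
  obtain ⟨r, a, v, f, g, h, ε, Λ₅, β₅, hvK, hfK, hgK, hhK, hv, hfg, hgh, hfh, hapos, ha0, hε, hfl⟩ := h G hG hcl
  refine ⟨r, a, v, f, g, h, ε, 0, Λ₅, β₅, hvK, hfK, hgK, hhK, hv, hfg, hgh, hfh, hapos, ha0, hε, le_rfl, ?_⟩
  intro c₀ hc₀ L hL
  exact ⟨c₀, le_rfl, by simp, (hfl c₀ hc₀ L hL).1, (hfl c₀ hc₀ L hL).2⟩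

/-- **`CofinalFloorsK` — the cofinal joint-floor currency (the weakest N-side input the leaf can consume).**  For every
SU(2)-class `G`: `r`, couplings `β_k → ∞`, units `u_k ∈ (0,1]` with `u_k → 0`, compact witnesses and a level `ε > 0`
such that for EVERY `k` both floors hold at `(β_k, u_k)` along SOME strictly increasing sequence of odd tori
`2 S_k(j) + 1` (not on all large tori, not at all large couplings).  The leaf quantifies `∃ β_k` and takes its
infinite-volume states in `oddTorusLimitPoints r (β_k)` = limits along ANY strictly increasing odd-torus sequence, so
this is exactly what its N-side consumes. -/
def CofinalFloorsK : Prop :=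
  ∀ (G : Type) [Group G] [TopologicalSpace G] [IsTopologicalGroup G] [CompactSpace G],
    IsCompactSimpleLieGroup G → Nonempty (G ≃ₜ* Matrix.specialUnitaryGroup (Fin 2) ℂ) →
    letI : MeasurableSpace G := borel G
    haveI : BorelSpace G := ⟨rfl⟩
    ∃ (r : LatticeRep G) (βk u : ℕ → ℝ) (v f g h : SchwartzMap (EuclideanSpace ℝ (Fin 4)) ℝ) (ε : ℝ),
      HasCompactSupport (v : EuclideanSpace ℝ (Fin 4) → ℝ) ∧ HasCompactSupport (f : EuclideanSpace ℝ (Fin 4) → ℝ) ∧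
      HasCompactSupport (g : EuclideanSpace ℝ (Fin 4) → ℝ) ∧ HasCompactSupport (h : EuclideanSpace ℝ (Fin 4) → ℝ) ∧
      tsupport v ⊆ {y : EuclideanSpace ℝ (Fin 4) | 0 < y 0} ∧
      Disjoint (tsupport f) (tsupport g) ∧ Disjoint (tsupport g) (tsupport h) ∧ Disjoint (tsupport f) (tsupport h) ∧
      (∀ k, 0 < u k) ∧ (∀ k, u k ≤ 1) ∧ Tendsto u atTop (nhds 0) ∧ Tendsto βk atTop atTop ∧ 0 < ε ∧
      ∀ k, ∃ S : ℕ → ℕ, StrictMono S ∧ ∀ j,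
        ε ≤ Q2 G r (βk k) (S j) (u k) (thetaTest 4 v) v ∧ ε ≤ |Q3 G r (βk k) (S j) (u k) f g h|

/-- `θ` preserves compact support (verbatim the tree's `WindowFromNontriviality.hasCompactSupport_thetaTest`, restated
to keep this workfile's imports light). [folklore] -/
private theorem hasCompactSupport_thetaTest' {w : SchwartzMap (EuclideanSpace ℝ (Fin 4)) ℝ}
    (hw : HasCompactSupport (w : EuclideanSpace ℝ (Fin 4) → ℝ)) :
    HasCompactSupport (thetaTest 4 w : EuclideanSpace ℝ (Fin 4) → ℝ) := by
  have heq : (thetaTest 4 w : EuclideanSpace ℝ (Fin 4) → ℝ) =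
      (w : EuclideanSpace ℝ (Fin 4) → ℝ) ∘ (timeReflection 4).toHomeomorph := by
    funext y
    simp [thetaTest_apply]
  rw [heq]
  exact hw.comp_homeomorph _

/-- Archimedean threshold: for `0 < u` there is `L₀ : ℕ` with `M ≤ u·(n + L₀)` for all `n`. [bookkeeping] -/
private theorem exists_threshold (M : ℝ) {u : ℝ} (hu : 0 < u) :
    ∃ L₀ : ℕ, ∀ n : ℕ, M ≤ u * ((n + L₀ : ℕ) : ℝ) := by
  refine ⟨⌈M / u⌉₊, fun n => ?_⟩
  have h1 : M / u ≤ (⌈M / u⌉₊ : ℝ) := Nat.le_ceil _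
  have h2 : (⌈M / u⌉₊ : ℝ) ≤ ((n + ⌈M / u⌉₊ : ℕ) : ℝ) := by exact_mod_cast Nat.le_add_left _ _
  have h3 : M / u * u = M := div_mul_cancel₀ M hu.ne'
  nlinarith [h1, h2, hu]

/-- A near-top `∀L`-floor unit: if some unit `s₀ ∈ (0,1]` has property `Fl`, there is a unit `w ∈ (0,1]` with `Fl`,
above half the supremum of such units — so no unit in `[2w, 1]` has `Fl`, and `w < 2s` for every unit `s` whose
`[2s, 1]` is `Fl`-free. [folklore; the selection behind «onset»] -/
private theorem exists_onset_unit (Fl : ℝ → Prop) {s₀ : ℝ} (hs₀0 : 0 < s₀) (hs₀1 : s₀ ≤ 1) (hFl : Fl s₀) :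
    ∃ w : ℝ, 0 < w ∧ w ≤ 1 ∧ Fl w ∧ (∀ s' : ℝ, 2 * w ≤ s' → s' ≤ 1 → ¬ Fl s') ∧
      (∀ s : ℝ, (∀ s' : ℝ, 2 * s ≤ s' → s' ≤ 1 → ¬ Fl s') → w < 2 * s) := by
  set P : Set ℝ := {s' : ℝ | 0 < s' ∧ s' ≤ 1 ∧ Fl s'} with hPdef
  have hs₀P : s₀ ∈ P := ⟨hs₀0, hs₀1, hFl⟩
  have hne : P.Nonempty := ⟨s₀, hs₀P⟩
  have hbdd : BddAbove P := ⟨1, fun s' hs' => hs'.2.1⟩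
  have hσ : 0 < sSup P := lt_of_lt_of_le hs₀0 (le_csSup hbdd hs₀P)
  obtain ⟨w, hwP, hσw⟩ := exists_lt_of_lt_csSup hne (half_lt_self hσ)
  refine ⟨w, hwP.1, hwP.2.1, hwP.2.2, fun s' h1 h2 hF => ?_, fun s hguard => ?_⟩
  · have hle := le_csSup hbdd (show s' ∈ P from ⟨by linarith [hwP.1], h2, hF⟩)
    linarith
  · by_contra hge
    exact hguard w (not_lt.1 hge) hwP.2.1 hwP.2.2

/-- **E_AM ⟹ item 26791 `AxisMirrorCeiling` BY NAME (kernel-checked).**  Under 26791's `∀β` antecedent every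
`β ≥ β₅` has a `∀L`-floor unit; the near-top such unit `w` (`exists_onset_unit`) satisfies E_AM's hypotheses (a), (b),
and `w < 2s` for every guarded unit `s` of 26791, so E_AM's ceiling at `w` with `ℓ₄` serves 26791 at `s` with `ℓ₄/2`
(the conclusion does not involve the unit). -/
theorem axisMirrorCeiling_of_onset (hE : AxisMirrorCeilingOnset) :
    Summit.QuantumFields.YangMills.Theses.SquareRootCeilings.AxisMirrorCeiling := by
  intro G _ _ _ _ hG hcl
  letI : MeasurableSpace G := borel G
  haveI : BorelSpace G := ⟨rfl⟩
  intro r v f g h Λ₅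
  obtain ⟨ε₀, hε₀, h1⟩ := hE G hG hcl r v f g h Λ₅
  refine ⟨ε₀, hε₀, fun ε hε hεε hFloors => ?_⟩
  obtain ⟨C, ℓ₄, β₄, hℓ₄, hC, h2⟩ := h1 ε hε hεε
  obtain ⟨β₅, hβ₅⟩ := hFloors
  refine ⟨C, ℓ₄ / 2, max β₄ β₅, half_pos hℓ₄, hC, ?_⟩
  intro β hβ s hs hs1 hsub L q k R t hq hR hRs hRL ht htL
  have hβ4 : β₄ ≤ β := le_trans (le_max_left _ _) hβ
  have hβ5 : β₅ ≤ β := le_trans (le_max_right _ _) hβ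
  obtain ⟨s₀, hs₀0, hs₀1, hF2, hF3⟩ := hβ₅ β hβ5
  obtain ⟨w, hw0, hw1, hFw, hguardw, hwlt⟩ := exists_onset_unit
    (fun s' : ℝ => (∀ L : ℕ, Λ₅ ≤ s' * L → ε ≤ Q2 G r β L s' (thetaTest 4 v) v) ∧
      (∀ L : ℕ, Λ₅ ≤ s' * L → ε ≤ |Q3 G r β L s' f g h|)) hs₀0 hs₀1 ⟨hF2, hF3⟩
  have hw2s : w < 2 * s := hwlt s hsub
  obtain ⟨L₀, hL₀⟩ := exists_threshold Λ₅ hw0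
  have hRw : (R : ℝ) * w ≤ ℓ₄ :=
    calc (R : ℝ) * w ≤ (R : ℝ) * (2 * s) := mul_le_mul_of_nonneg_left hw2s.le (Nat.cast_nonneg R)
      _ = 2 * ((R : ℝ) * s) := by ring
      _ ≤ ℓ₄ := by linarith
  exact h2 β hβ4 w hw0 hw1 ⟨fun j => j + L₀, fun i j hij => Nat.add_lt_add_right hij L₀,
      fun j => ⟨hFw.1 _ (hL₀ j), hFw.2 _ (hL₀ j)⟩⟩ hguardw L q k R t hq hR hRw hRL ht htL

/-- **E ⟹ item 26671 `SubOnsetTwoPointCeilings` BY NAME (kernel-checked; same selection).** -/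
theorem subOnsetTwoPointCeilings_of_onset (hE : SubOnsetTwoPointCeilingsOnset) :
    Summit.QuantumFields.YangMills.Theses.SquareRootCeilings.SubOnsetTwoPointCeilings := by
  intro G _ _ _ _ hG hcl
  letI : MeasurableSpace G := borel G
  haveI : BorelSpace G := ⟨rfl⟩
  intro r v f g h Λ₅
  obtain ⟨ε₀, hε₀, h1⟩ := hE G hG hcl r v f g h Λ₅
  refine ⟨ε₀, hε₀, fun ε hε hεε hFloors => ?_⟩
  obtain ⟨C, ℓ₄, β₄, hℓ₄, hC, h2⟩ := h1 ε hε hεε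
  obtain ⟨β₅, hβ₅⟩ := hFloors
  refine ⟨C, ℓ₄ / 2, max β₄ β₅, half_pos hℓ₄, hC, ?_⟩
  intro β hβ s hs hs1 hsub L q q' x y R hq hq' hR hRs hRL hsep
  have hβ4 : β₄ ≤ β := le_trans (le_max_left _ _) hβ
  have hβ5 : β₅ ≤ β := le_trans (le_max_right _ _) hβ
  obtain ⟨s₀, hs₀0, hs₀1, hF2, hF3⟩ := hβ₅ β hβ5
  obtain ⟨w, hw0, hw1, hFw, hguardw, hwlt⟩ := exists_onset_unit
    (fun s' : ℝ => (∀ L : ℕ, Λ₅ ≤ s' * L → ε ≤ Q2 G r β L s' (thetaTest 4 v) v) ∧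
      (∀ L : ℕ, Λ₅ ≤ s' * L → ε ≤ |Q3 G r β L s' f g h|)) hs₀0 hs₀1 ⟨hF2, hF3⟩
  have hw2s : w < 2 * s := hwlt s hsub
  obtain ⟨L₀, hL₀⟩ := exists_threshold Λ₅ hw0
  have hRw : (R : ℝ) * w ≤ ℓ₄ :=
    calc (R : ℝ) * w ≤ (R : ℝ) * (2 * s) := mul_le_mul_of_nonneg_left hw2s.le (Nat.cast_nonneg R)
      _ = 2 * ((R : ℝ) * s) := by ring
      _ ≤ ℓ₄ := by linarith
  exact h2 β hβ4 w hw0 hw1 ⟨fun j => j + L₀, fun i j hij => Nat.add_lt_add_right hij L₀,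
      fun j => ⟨hFw.1 _ (hL₀ j), hFw.2 _ (hL₀ j)⟩⟩ hguardw L q q' x y R hq hq' hR hRw hRL hsep

/-- **SELECTION (kernel-checked): window floors + coupling equicontinuity ⟹ cofinal floors.**  Per window
`[c₀(k), c₀(k)+T₀]`, `c₀(k) = B + k`: the couplings `c(L) ∈ [c₀, c₀+T₀]` of N1 (one per large torus) have a convergent
subsequence `c(L_j) → β_k` (Bolzano–Weierstrass); N2 moves the floors `ε` at `(c(L_j), L_j)` to floors `ε/2` at
`(β_k, L_j)` for `j` large, in the unit `u_k = a(c₀(k)) → 0`.  This is step (1) of the cofinal engine, proved. -/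
theorem cofinalFloorsK_of_windows (h1 : WindowFloorsK) (h2 : WindowLipschitz) : CofinalFloorsK := by
  intro G _ _ _ _ hG hcl
  letI : MeasurableSpace G := borel G
  haveI : BorelSpace G := ⟨rfl⟩
  obtain ⟨r, a, v, f, g, h, ε, T₀, Λ₅, β₅, hvK, hfK, hgK, hhK, hv, hfg, hgh, hfh, hapos, ha0, hε, hT₀, hW⟩ :=
    h1 G hG hcl
  obtain ⟨K₂, Λ₆, β₆, hK₂, hL2⟩ := h2 G hG hcl r a v f g h ε T₀ Λ₅ β₅ hvK hgK hhK hv hfg hgh hfh hapos ha0 hε hT₀ hW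
  obtain ⟨K₃, Λ₇, β₇, hK₃, hL3⟩ := h2 G hG hcl r a v f g h ε T₀ Λ₅ β₅ hvK hgK hhK hv hfg hgh hfh hapos ha0 hε hT₀ hW
  -- a base coupling beyond which the unit is `≤ 1`
  obtain ⟨B₀, hB₀⟩ : ∃ B₀ : ℝ, ∀ c, B₀ ≤ c → a c ≤ 1 :=
    Filter.eventually_atTop.1 (ha0.eventually (eventually_le_nhds one_pos))
  set B : ℝ := max (max β₅ B₀) (max β₆ β₇) with hBdef
  have hB5 : β₅ ≤ B := (le_max_left _ _).trans (le_max_left _ _)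
  have hB0 : B₀ ≤ B := (le_max_right _ _).trans (le_max_left _ _)
  have hB6 : β₆ ≤ B := (le_max_left _ _).trans (le_max_right _ _)
  have hB7 : β₇ ≤ B := (le_max_right _ _).trans (le_max_right _ _)
  have hBk : ∀ k : ℕ, B ≤ B + (k : ℝ) := fun k => le_add_of_nonneg_right (Nat.cast_nonneg k)
  -- the per-window selection
  have key : ∀ k : ℕ, ∃ (β' : ℝ) (S : ℕ → ℕ), B + (k : ℝ) ≤ β' ∧ StrictMono S ∧ ∀ j,
      ε / 2 ≤ Q2 G r β' (S j) (a (B + k)) (thetaTest 4 v) v ∧ ε / 2 ≤ |Q3 G r β' (S j) (a (B + k)) f g h| := by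
    intro k
    set c₀ : ℝ := B + (k : ℝ) with hc₀def
    have hc₀5 : β₅ ≤ c₀ := hB5.trans (hBk k)
    have hc₀6 : β₆ ≤ c₀ := hB6.trans (hBk k)
    have hc₀7 : β₇ ≤ c₀ := hB7.trans (hBk k)
    have hs : 0 < a c₀ := hapos c₀
    have hs1 : a c₀ ≤ 1 := hB₀ c₀ (hB0.trans (hBk k))
    obtain ⟨L₀, hL₀⟩ := exists_threshold (max Λ₅ (max Λ₆ Λ₇)) hs
    have hthr5 : ∀ n : ℕ, Λ₅ ≤ a c₀ * ((n + L₀ : ℕ) : ℝ) := fun n => (le_max_left _ _).trans (hL₀ n)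
    have hthr6 : ∀ n : ℕ, Λ₆ ≤ a c₀ * ((n + L₀ : ℕ) : ℝ) :=
      fun n => ((le_max_left _ _).trans (le_max_right _ _)).trans (hL₀ n)
    have hthr7 : ∀ n : ℕ, Λ₇ ≤ a c₀ * ((n + L₀ : ℕ) : ℝ) :=
      fun n => ((le_max_right _ _).trans (le_max_right _ _)).trans (hL₀ n)
    have hWn : ∀ n : ℕ, ∃ c : ℝ, c₀ ≤ c ∧ c ≤ c₀ + T₀ ∧
        ε ≤ Q2 G r c (n + L₀) (a c₀) (thetaTest 4 v) v ∧ ε ≤ |Q3 G r c (n + L₀) (a c₀) f g h| :=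
      fun n => hW c₀ hc₀5 (n + L₀) (hthr5 n)
    choose c hc using hWn
    -- Bolzano–Weierstrass on the window
    obtain ⟨β', hβ'cl, φ, hφ, hlim⟩ :=
      tendsto_subseq_of_bounded (Metric.isBounded_Icc c₀ (c₀ + T₀)) (x := c) (fun n => ⟨(hc n).1, (hc n).2.1⟩)
    have hβ'mem : β' ∈ Set.Icc c₀ (c₀ + T₀) := by rwa [closure_Icc] at hβ'cl
    -- the Lipschitz errors go to zero along the subsequence
    have habs : Tendsto (fun j => |c (φ j) - β'|) atTop (nhds 0) := by
      have h0 : Tendsto (fun j => c (φ j) - β') atTop (nhds (β' - β')) := hlim.sub_const β'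
      rw [sub_self] at h0
      simpa using h0.abs
    have hsmall : ∀ᶠ j in atTop, K₂ * |c (φ j) - β'| ≤ ε / 2 ∧ K₃ * |c (φ j) - β'| ≤ ε / 2 := by
      have h2' : Tendsto (fun j => K₂ * |c (φ j) - β'|) atTop (nhds 0) := by simpa using habs.const_mul K₂
      have h3' : Tendsto (fun j => K₃ * |c (φ j) - β'|) atTop (nhds 0) := by simpa using habs.const_mul K₃
      exact (h2'.eventually (eventually_le_nhds (half_pos hε))).and
        (h3'.eventually (eventually_le_nhds (half_pos hε)))
    obtain ⟨j₀, hj₀⟩ := Filter.eventually_atTop.1 hsmall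
    refine ⟨β', fun j => φ (j + j₀) + L₀, hβ'mem.1, ?_, ?_⟩
    · intro i j hij
      exact Nat.add_lt_add_right (hφ (Nat.add_lt_add_right hij j₀)) L₀
    · intro j
      obtain ⟨h2s, h3s⟩ := hj₀ (j + j₀) (Nat.le_add_left _ _)
      obtain ⟨hcl, hcu, hfl2, hfl3⟩ := hc (φ (j + j₀))
      have hLip2 := (hL2 c₀ hc₀6 (c (φ (j + j₀))) β' hcl hcu hβ'mem.1 hβ'mem.2 (φ (j + j₀) + L₀) (hthr6 _)).1
      have hLip3 := (hL3 c₀ hc₀7 (c (φ (j + j₀))) β' hcl hcu hβ'mem.1 hβ'mem.2 (φ (j + j₀) + L₀) (hthr7 _)).2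
      refine ⟨?_, ?_⟩
      · have hd := (abs_sub_le_iff.1 (hLip2.trans h2s)).1
        linarith
      · have hd := hLip3.trans h3s
        have htri := abs_sub_abs_le_abs_sub (Q3 G r (c (φ (j + j₀))) (φ (j + j₀) + L₀) (a c₀) f g h)
          (Q3 G r β' (φ (j + j₀) + L₀) (a c₀) f g h)
        linarith
  choose βk S hβk hS hfl using key
  refine ⟨r, βk, fun k => a (B + k), v, f, g, h, ε / 2, hvK, hfK, hgK, hhK, hv, hfg, hgh, hfh,
    fun k => hapos _, fun k => hB₀ _ (hB0.trans (hBk k)), ?_, ?_, half_pos hε, fun k => ⟨S k, hS k, hfl k⟩⟩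
  · exact ha0.comp (tendsto_atTop_add_const_left atTop B tendsto_natCast_atTop_atTop)
  · exact tendsto_atTop_mono hβk (tendsto_atTop_add_const_left atTop B tendsto_natCast_atTop_atTop)

/-- **`CofinalSubOnsetFloorsK` — cofinal joint floors at a SUB-ONSET unit (REV 3; the typed object idea-crit-9 #90
asked for).**  For every SU(2)-class `G`: `r`, compact witnesses `(v; f,g,h)` as in `CofinalFloorsK`, a level `ε₁ > 0`,
and for EVERY threshold `Λ₅` and EVERY level `0 < ε ≤ ε₁`: couplings `β_k → ∞` and units `w_k ∈ (0,1]`, `w_k → 0`, such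
that for every `k` (a) BOTH floors of level `ε` hold at `(β_k, w_k)` along a strictly increasing odd-torus sequence and
(b) `w_k` is SUB-ONSET of level `ε`: no scale `s' ∈ [2w_k, 1]` carries the two `∀L`-floors of level `ε` (threshold
`Λ₅`) at `β_k` — literally the antecedent under which E `SubOnsetTwoPointCeilingsOnset` delivers its ceiling. -/
def CofinalSubOnsetFloorsK : Prop :=
  ∀ (G : Type) [Group G] [TopologicalSpace G] [IsTopologicalGroup G] [CompactSpace G],
    IsCompactSimpleLieGroup G → Nonempty (G ≃ₜ* Matrix.specialUnitaryGroup (Fin 2) ℂ) →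
    letI : MeasurableSpace G := borel G
    haveI : BorelSpace G := ⟨rfl⟩
    ∃ (r : LatticeRep G) (v f g h : SchwartzMap (EuclideanSpace ℝ (Fin 4)) ℝ) (ε₁ : ℝ),
      HasCompactSupport (v : EuclideanSpace ℝ (Fin 4) → ℝ) ∧ HasCompactSupport (f : EuclideanSpace ℝ (Fin 4) → ℝ) ∧
      HasCompactSupport (g : EuclideanSpace ℝ (Fin 4) → ℝ) ∧ HasCompactSupport (h : EuclideanSpace ℝ (Fin 4) → ℝ) ∧
      tsupport v ⊆ {y : EuclideanSpace ℝ (Fin 4) | 0 < y 0} ∧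
      Disjoint (tsupport f) (tsupport g) ∧ Disjoint (tsupport g) (tsupport h) ∧ Disjoint (tsupport f) (tsupport h) ∧
      0 < ε₁ ∧
      ∀ (Λ₅ ε : ℝ), 0 < ε → ε ≤ ε₁ → ∃ (βk w : ℕ → ℝ),
        (∀ k, 0 < w k) ∧ (∀ k, w k ≤ 1) ∧ Tendsto w atTop (nhds 0) ∧ Tendsto βk atTop atTop ∧
        ∀ k, (∃ S : ℕ → ℕ, StrictMono S ∧ ∀ j,
              ε ≤ Q2 G r (βk k) (S j) (w k) (thetaTest 4 v) v ∧ ε ≤ |Q3 G r (βk k) (S j) (w k) f g h|) ∧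
          (∀ s' : ℝ, 2 * w k ≤ s' → s' ≤ 1 →
            ¬ ((∀ L : ℕ, Λ₅ ≤ s' * L → ε ≤ Q2 G r (βk k) L s' (thetaTest 4 v) v) ∧
               (∀ L : ℕ, Λ₅ ≤ s' * L → ε ≤ |Q3 G r (βk k) L s' f g h|)))

/-- **ENGINE-a′ (REV 3, kernel-checked): cofinal floors ⟹ cofinal floors at a sub-onset unit.**  Per `k`, at level
`ε ≤ ε₁` and threshold `Λ₅`: if some scale `s' ∈ [2u_k, 1]` carries both `∀L`-floors at `β_k`, let `σ_k` be the
supremum of such scales and pick such a scale `w_k > σ_k/2` (so every `s' ≥ 2w_k > σ_k` carries none, and `w_k` itself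
carries `∀L`-floors, hence floors along `j ↦ j + ⌈Λ₅/w_k⌉`); otherwise `w_k := u_k` (floors along the given
subsequence, sub-onset by the case hypothesis).  `w_k → 0`: `u_k → 0`, and a scale `≥ δ` carrying `∀L`-floors at
`β_k ≥ β₁(δ)` is excluded by the landed `OnsetCalibration.onsetVanishes_proof` (fixed-torus freezing). -/
theorem cofinalSubOnsetFloorsK_of_cofinalFloorsK (h1 : CofinalFloorsK) : CofinalSubOnsetFloorsK := by
  intro G _ _ _ _ hG hcl
  letI : MeasurableSpace G := borel G
  haveI : BorelSpace G := ⟨rfl⟩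
  obtain ⟨r, βk, u, v, f, g, h, ε₁, hvK, hfK, hgK, hhK, hv, hfg, hgh, hfh, hu0, hu1, hu, hβ, hε₁, hfl⟩ := h1 G hG hcl
  refine ⟨r, v, f, g, h, ε₁, hvK, hfK, hgK, hhK, hv, hfg, hgh, hfh, hε₁, fun Λ₅ ε hε hεε₁ => ?_⟩
  -- the per-`k` selection of the unit
  have key : ∀ k : ℕ, ∃ w : ℝ, u k ≤ w ∧ w ≤ 1 ∧
      (∃ S : ℕ → ℕ, StrictMono S ∧ ∀ j,
        ε ≤ Q2 G r (βk k) (S j) w (thetaTest 4 v) v ∧ ε ≤ |Q3 G r (βk k) (S j) w f g h|) ∧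
      (∀ s' : ℝ, 2 * w ≤ s' → s' ≤ 1 →
        ¬ ((∀ L : ℕ, Λ₅ ≤ s' * L → ε ≤ Q2 G r (βk k) L s' (thetaTest 4 v) v) ∧
           (∀ L : ℕ, Λ₅ ≤ s' * L → ε ≤ |Q3 G r (βk k) L s' f g h|))) ∧
      (w = u k ∨
        ((∀ L : ℕ, Λ₅ ≤ w * L → ε ≤ Q2 G r (βk k) L w (thetaTest 4 v) v) ∧
         (∀ L : ℕ, Λ₅ ≤ w * L → ε ≤ |Q3 G r (βk k) L w f g h|))) := by
    intro k
    have huk : 0 < u k := hu0 k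
    by_cases hA : ∃ s' : ℝ, 2 * u k ≤ s' ∧ s' ≤ 1 ∧
        ((∀ L : ℕ, Λ₅ ≤ s' * L → ε ≤ Q2 G r (βk k) L s' (thetaTest 4 v) v) ∧
         (∀ L : ℕ, Λ₅ ≤ s' * L → ε ≤ |Q3 G r (βk k) L s' f g h|))
    · -- case A: a near-maximal `∀L`-floor scale
      set P : Set ℝ := {s' : ℝ | 2 * u k ≤ s' ∧ s' ≤ 1 ∧
        ((∀ L : ℕ, Λ₅ ≤ s' * L → ε ≤ Q2 G r (βk k) L s' (thetaTest 4 v) v) ∧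
         (∀ L : ℕ, Λ₅ ≤ s' * L → ε ≤ |Q3 G r (βk k) L s' f g h|))} with hPdef
      have hPne : P.Nonempty := hA
      have hPbdd : BddAbove P := ⟨1, fun s' hs' => hs'.2.1⟩
      obtain ⟨s₀, hs₀⟩ := hA
      have hσpos : 0 < sSup P := lt_of_lt_of_le (by linarith [hs₀.1]) (le_csSup hPbdd hs₀)
      obtain ⟨w, hwP, hσw⟩ := exists_lt_of_lt_csSup hPne (half_lt_self hσpos)
      have hw0 : 0 < w := by linarith [hwP.1]
      obtain ⟨L₀, hL₀⟩ := exists_threshold Λ₅ hw0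
      refine ⟨w, by linarith [hwP.1], hwP.2.1, ⟨fun j => j + L₀, fun i j hij => Nat.add_lt_add_right hij L₀,
        fun j => ⟨hwP.2.2.1 _ (hL₀ j), hwP.2.2.2 _ (hL₀ j)⟩⟩, ?_, Or.inr hwP.2.2⟩
      intro s' hs'1 hs'2 hFl
      have hs'P : s' ∈ P := ⟨by linarith [hwP.1], hs'2, hFl⟩
      have hle := le_csSup hPbdd hs'P
      linarith
    · -- case B: the given unit is already sub-onset
      obtain ⟨S, hS, hflS⟩ := hfl k
      exact ⟨u k, le_rfl, hu1 k, ⟨S, hS, fun j => ⟨hεε₁.trans (hflS j).1, hεε₁.trans (hflS j).2⟩⟩,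
        fun s' h1 h2 hFl => hA ⟨s', h1, h2, hFl⟩, Or.inl rfl⟩
  choose w hwu hw1 hwS hwsub hwcase using key
  have hwpos : ∀ k, 0 < w k := fun k => lt_of_lt_of_le (hu0 k) (hwu k)
  refine ⟨βk, w, hwpos, hw1, ?_, hβ, fun k => ⟨hwS k, hwsub k⟩⟩
  -- `w_k → 0`
  rw [Metric.tendsto_atTop]
  intro δ hδ
  obtain ⟨β₁, hβ₁⟩ :=
    Summit.QuantumFields.YangMills.Theorems.OnsetCalibration.onsetVanishes_proof G hG hcl r v f g h ε Λ₅ δ hε hδ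
  obtain ⟨k₁, hk₁⟩ := Filter.eventually_atTop.1 (hβ.eventually_ge_atTop β₁)
  obtain ⟨k₂, hk₂⟩ := (Metric.tendsto_atTop.1 hu) δ hδ
  refine ⟨max k₁ k₂, fun k hk => ?_⟩
  have hk1 : β₁ ≤ βk k := hk₁ k ((le_max_left _ _).trans hk)
  have hk2 := hk₂ k ((le_max_right _ _).trans hk)
  rw [Real.dist_0_eq_abs, abs_of_pos (hu0 k)] at hk2
  rw [Real.dist_0_eq_abs, abs_of_pos (hwpos k)]
  rcases hwcase k with hB | hFl
  · rw [hB]; exact hk2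
  · by_contra hge
    exact hβ₁ (βk k) hk1 (w k) (not_lt.1 hge) (hw1 k) hFl

/-! ## §2 The registered stubs -/

/-- ★ **N1 `stub_windowFloors`** — window floors (FRS-class output: Feynman–Hellmann drop ⇒ slope ⇒ skewness at one
coupling per window and per torus, in the fixed unit `a(c₀)`; produced from NT clause (i) + `RunningCouplingCeiling` +
`ResponseLocalisation` of route ForcedResponseSkewness WITHOUT its scaling-limit residual clauses).  [N-wall; hard] -/
theorem stub_windowFloors : WindowFloorsK := by
  sorry

/-- ★ **N2′ `stub_windowResponseBound`** (CORRECTED currency) — the window response bound: wherever window floors hold (N1's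
property, disjointly supported tests, unit `a(c₀)`), the coupling derivative of the smeared torus two- and
three-point functions at that unit is bounded by ONE `K` across every window `[c₀, c₀+T₀]`, uniformly in the volume
(Feynman–Hellmann: the smeared third / fourth cumulant with one leg summed against the action over the torus — a
response ceiling at the floors' unit; E-wall-adjacent upper-bound class, n = 2, 3, derivative form; contact terms are
absent because the tests are disjointly supported, the infrared regime `s ≪ a(β)` is absent because the unit is the
floors' own).  N2 follows (`windowLipschitz_of_responseBound`). -/
theorem stub_windowResponseBound : WindowResponseBound := by
  sorry

/-- ★ **E_AM `stub_axisMirrorCeilingOnset`** (REV 7∕6: onset-conditioned form of item 26791, idea-crit-9 #90c P2 form β)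
— the on-axis same-orientation mirror-pair plaquette ceiling `(C/R⁴)²` at axis separations `t ∈ [2R+2, L]`,
`R s ≤ ℓ₄`, owed at every `(β ≥ β₄, s)` where `s` carries the tests' floors along a torus sequence and no unit in
`[2s,1]` carries `∀L`-floors (floor-less instances vacuous).  `⇒ 26791` and `⇒ E ⇒ 26671` BY NAME (proved above).
[E-wall, n = 2, on-axis; SU(2)-class; the open content of route SquareRootCeilings] -/
theorem stub_axisMirrorCeilingOnset : AxisMirrorCeilingOnset := by
  sorry

/-- ★ **E′ `stub_smearedMomentBound`** — OnsetTautology's smeared all-order ceiling currency BY NAME (the conclusion of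
the landed E3 `MirrorCalibration.stub_smearedAtomicBound` from `AtomCeilings`, the landed Whitney package,
`AtomicSynthesis` 28167 and `AtomicSqrtDominationR` 28168).  [E-wall n ≥ 2; by name] -/
theorem stub_smearedMomentBound : SmearedMomentBound := by
  sorry

/-- ★ **ENGINE-b `stub_cofinalEngineB`** (SOFT, provable-grade, L/XL; REV 3) — the cofinal re-run of the landed calibration
and IV engines from the SUB-ONSET cofinal currency (steps (1) selection and (2) sub-onset unit are PROVED above:
`cofinalFloorsK_of_windows`, `cofinalSubOnsetFloorsK_of_cofinalFloorsK`).  Internals, all over landed tools: fix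
`Λ₅` as `twoPoint_limitState` wants and the level `ε := min ε₁ ε₀` with `ε₀` from E at `(r, v, f, g, h, Λ₅)`;
(3) CEILINGS at `(β_k, w_k)` from E (its hypotheses are clauses (a), (b) of the currency), inherited by every odd-torus limit
state ALONG THE FLOOR SUBSEQUENCE (`twoPoint_limitState`), onset domination of the admissible `b`-profile below
`K·w_k` (`rpSquare_le_coarse/fine`), hence E′ applies at `(β_k, μ_k, K w_k)`; (4) the smeared IV engine of
`smearedIVDataK_proof` run along `k` (floors transferred to `μ_k` chosen along the subsequence; ceilings from E′;
Prokhorov/diagonal extraction, OS properties inherited as in B7K; the leaf's unit function `a` interpolates `w_k` at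
`β_k`).  No `∀β` statement is produced or needed: the leaf asks `∃ β_k`. -/
theorem stub_cofinalEngineB :
    CofinalSubOnsetFloorsK → SubOnsetTwoPointCeilingsOnset → SmearedMomentBound →
      Summit.QuantumFields.YangMills.Theses.InfiniteVolumeContinuum.HypercubicOSDataFromInfiniteVolume := by
  sorry

/-! ## §3 The composition (sorry-free) -/

/-- **The composition (REV 3).**  Summed-response bound (N2′) ⟹ coupling equicontinuity (MVT, proved); with window
floors (N1) ⟹ cofinal floors (selection, proved) ⟹ cofinal floors at a sub-onset unit (ENGINE-a′, proved); with the
antecedent-free two-point sub-onset ceiling (E) and the smeared moment bound (E′) ⟹ the leaf, through ENGINE-b. -/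
theorem HypercubicOSDataFromInfiniteVolume_of_cofinalWindows :
    Summit.QuantumFields.YangMills.Theses.InfiniteVolumeContinuum.HypercubicOSDataFromInfiniteVolume :=
  stub_cofinalEngineB
    (cofinalSubOnsetFloorsK_of_cofinalFloorsK
      (cofinalFloorsK_of_windows stub_windowFloors (windowLipschitz_of_responseBound stub_windowResponseBound)))
    (subOnsetTwoPointCeilingsOnset_of_axisMirrorOnset stub_axisMirrorCeilingOnset) stub_smearedMomentBound

end Summit.QuantumFields.YangMills.Cruxes.HypercubicOSDataFromInfiniteVolume.CofinalWindows

end
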